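import Mathlib
import Summits.Ventures.PercRepro2.Defs
import Summits.Ventures.PercRepro2.Graph
import Summits.Ventures.PercRepro2.Events
import Summits.Ventures.PercRepro2.Harris
import Summits.Ventures.PercRepro2.Independence
import Summits.Ventures.PercRepro2.CutVertexPaths
import Summits.Ventures.PercRepro2.XWForm
import Summits.Ventures.PercRepro2.XWMore
import Summits.Ventures.PercRepro2.XWCutVertex
import Summits.Ventures.PercRepro2.XWEdgeSY

/-!
# The `s–y` defect of (XW) on the glued (cut-vertex) family, in closed form (PercRepro2, p2 g27)

Every (XW) witness of record (96 / 96, P2-G27-CYU.md §5b) is «a cut-vertex configuration plus one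
`s–y` edge»: a vertex `v` separates `{s, u}` (left block) from `{y, o}` (right block), `XW = 0`
there (XWCutVertex `xwBil_eq_zero_of_cut_su_yo`), and the `s–y` edge of weight `t` contributes
`XW = t(1 − t)·D_sy` (XWEdgeSY `xwBil_eq_sy_edge`).  This file computes the defect

  `D_sy = P(Q)·P(Q ∩ U ∩ O) − P(Q ∩ a)·P(Q ∩ {s ↔ o}) − P(Q ∩ λ)·P(Q ∩ U)`

(`Q = {s ↮ y}`, `a = {s ↔ u}`, `λ = {y ↔ o}`, `U = {s ↔ u} ∪ {y ↔ u}`, `O = {y ↔ o} ∪ {s ↔ o}`)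
on such a configuration EXACTLY, in terms of four block statistics — on the left block
`Δ_L = Cov(s ↔ v, s ↔ u)` (`≥ 0` by Harris) and `A₃ = P(u ↔ v, s ↮ v)`, on the right block
`Δ_R = Cov(y ↔ v, y ↔ o)` (`≥ 0`) and `C₃ = P(o ↔ v, y ↮ v)`:

  **`D_sy = A₃·Δ_R + C₃·Δ_L − Δ_L·Δ_R`**   (`dSY_eq_glue`).

So on the glued family (XW) with the `s–y` edge holds iff `A₃·Δ_R + C₃·Δ_L ≥ Δ_L·Δ_R`, i.e.
`A₃/Δ_L + C₃/Δ_R ≥ 1`: the violation needs both blocks to leak to the cut vertex from the second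
mark (`A₃`, `C₃`) less than their own covariances — the «doubly near-pendant» regime of every
witness (on `g6` of XWCounterexample6.lean, `A₃/Δ_L ≈ 0.55`, `C₃/Δ_R ≈ 0.43`).  Equality cases:
`u` pendant at `s` (`A₃ = Δ_L = 0`) or `o` pendant at `y`.

Proof: with `A, B, a = {s ↔ v}, {u ↔ v}, {s ↔ u}` (left edges only) and `C, D, λ = {y ↔ v},
{o ↔ v}, {y ↔ o}` (right edges only), the cross events are `{s ↔ y} = A ∩ C`, `{s ↔ o} = A ∩ D`,
`{y ↔ u} = B ∩ C` (`connEvent_cross`), `B ∩ a ⊆ A` and `D ∩ λ ⊆ C`; the six probabilities of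
`D_sy` split into left × right rectangles (`prob_inter_left_right`) and the rest is a polynomial
identity.  Own work (record proofs/P2-G27-CYU.md §5c); standard axioms.
-/

namespace Summit.Ventures.PercRepro2

namespace XWGlue

open CutVertexM9 XWCut

variable {V : Type*} {E : Type*} [Fintype E] [DecidableEq E]
  {R : Type*} [CommRing R] [LinearOrder R] [IsStrictOrderedRing R]
  {ends : E → Sym2 V} {side : E → Bool} {L : Set V} {v : V} {Rt : Set V}

omit [Fintype E] [DecidableEq E] in
/-- `{u ↔ v} ∩ {s ↔ u} ⊆ {s ↔ v}`. -/
lemma inter_subset_conn_trans (x z w : V) :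
    connEvent ends z w ∩ connEvent ends x z ⊆ connEvent ends x w := by
  rintro ω ⟨h1, h2⟩
  exact conn_trans h2 h1

omit [LinearOrder R] [IsStrictOrderedRing R] in
/-- **The `s–y` defect on a cut-vertex configuration** (`s, u` left, `y, o` right):
`D_sy = A₃·Δ_R + C₃·Δ_L − Δ_L·Δ_R` with `A₃ = P(u ↔ v, s ↮ v)`, `C₃ = P(o ↔ v, y ↮ v)`,
`Δ_L = P(s ↔ u, s ↔ v) − P(s ↔ v)·P(s ↔ u)`, `Δ_R = P(y ↔ o, y ↔ v) − P(y ↔ v)·P(y ↔ o)`. -/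
theorem dSY_eq_glue (h : CutVertex ends side L v Rt) {s u y o : V}
    (hs : s ∈ L ∨ s = v) (hu : u ∈ L ∨ u = v) (hy : y ∈ Rt ∨ y = v) (ho : o ∈ Rt ∨ o = v)
    (p : E → R) :
    XWEdgeSY.dSY ends s y o u p =
      prob p (connEvent ends u v ∩ (connEvent ends s v)ᶜ) *
          (prob p (connEvent ends y o ∩ connEvent ends y v) -
            prob p (connEvent ends y v) * prob p (connEvent ends y o)) +
        prob p (connEvent ends o v ∩ (connEvent ends y v)ᶜ) *
          (prob p (connEvent ends s u ∩ connEvent ends s v) -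
            prob p (connEvent ends s v) * prob p (connEvent ends s u)) -
        (prob p (connEvent ends s u ∩ connEvent ends s v) -
            prob p (connEvent ends s v) * prob p (connEvent ends s u)) *
          (prob p (connEvent ends y o ∩ connEvent ends y v) -
            prob p (connEvent ends y v) * prob p (connEvent ends y o)) := by
  -- the cross events
  have hS : connEvent ends s y = connEvent ends s v ∩ connEvent ends y v := connEvent_cross h hs hy
  have hso : connEvent ends s o = connEvent ends s v ∩ connEvent ends o v :=
    connEvent_cross h hs ho
  have hyu : connEvent ends y u = connEvent ends u v ∩ connEvent ends y v := by
    rw [connEvent_comm]; exact connEvent_cross h hu hy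
  unfold XWEdgeSY.dSY XWEdgeSY.U XWEdgeSY.O
  rw [hS, hso, hyu]
  -- names
  set A := connEvent ends s v with hA
  set B := connEvent ends u v with hB
  set a := connEvent ends s u with ha
  set C := connEvent ends y v with hC
  set D := connEvent ends o v with hD
  set l := connEvent ends y o with hl
  -- the two containments
  have hBa : B ∩ a ⊆ A := inter_subset_conn_trans s u v
  have hDl : D ∩ l ⊆ C := inter_subset_conn_trans y o v
  -- what depends on which side
  have dA : DependsOn (· ∈ A) {e | side e = true} := dependsOn_connEvent_left h hs (Or.inr rfl)
  have dB : DependsOn (· ∈ B) {e | side e = true} := dependsOn_connEvent_left h hu (Or.inr rfl)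
  have da : DependsOn (· ∈ a) {e | side e = true} := dependsOn_connEvent_left h hs hu
  have dC : DependsOn (· ∈ C) {e | side e = false} := dependsOn_connEvent_right h hy (Or.inr rfl)
  have dD : DependsOn (· ∈ D) {e | side e = false} := dependsOn_connEvent_right h ho (Or.inr rfl)
  have dl : DependsOn (· ∈ l) {e | side e = false} := dependsOn_connEvent_right h hy ho
  have dBA : DependsOn (· ∈ B ∩ Aᶜ) {e | side e = true} :=
    dependsOn_inter_same dB (dependsOn_compl dA)
  have daA : DependsOn (· ∈ a ∩ A) {e | side e = true} := dependsOn_inter_same da dA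
  have dDC : DependsOn (· ∈ D ∩ Cᶜ) {e | side e = false} :=
    dependsOn_inter_same dD (dependsOn_compl dC)
  have dlC : DependsOn (· ∈ l ∩ C) {e | side e = false} := dependsOn_inter_same dl dC
  -- (1) `P(Q) = 1 − P(A)P(C)`
  have h1 : prob p (A ∩ C)ᶜ = 1 - prob p A * prob p C := by
    rw [prob_compl, prob_inter_left_right p dA dC]
  -- (3) `P(Q ∩ a) = P(a) − P(a ∩ A)·P(C)`
  have h3 : prob p ((A ∩ C)ᶜ ∩ a) = prob p a - prob p (a ∩ A) * prob p C := by
    have e0 := prob_inter_add_prob_inter_compl p a (A ∩ C)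
    have e : a ∩ (A ∩ C) = (a ∩ A) ∩ C := (Set.inter_assoc _ _ _).symm
    rw [e, prob_inter_left_right p daA dC, Set.inter_comm a (A ∩ C)ᶜ] at e0
    linear_combination e0
  -- (4) `P(Q ∩ {s ↔ o}) = P(A)·P(D ∩ Cᶜ)`
  have h4 : prob p ((A ∩ C)ᶜ ∩ (A ∩ D)) = prob p A * prob p (D ∩ Cᶜ) := by
    have e : (A ∩ C)ᶜ ∩ (A ∩ D) = A ∩ (D ∩ Cᶜ) := by
      ext ω; simp only [Set.mem_inter_iff, Set.mem_compl_iff]; tauto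
    rw [e, prob_inter_left_right p dA dDC]
  -- (5) `P(Q ∩ λ) = P(λ) − P(A)·P(λ ∩ C)`
  have h5 : prob p ((A ∩ C)ᶜ ∩ l) = prob p l - prob p A * prob p (l ∩ C) := by
    have e0 := prob_inter_add_prob_inter_compl p l (A ∩ C)
    have e : l ∩ (A ∩ C) = A ∩ (l ∩ C) := by
      ext ω; simp only [Set.mem_inter_iff]; tauto
    rw [e, prob_inter_left_right p dA dlC, Set.inter_comm l (A ∩ C)ᶜ] at e0
    linear_combination e0
  -- (6) `P(Q ∩ U) = P(Q ∩ a) + P(B ∩ Aᶜ)·P(C)`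
  have h6 : prob p ((A ∩ C)ᶜ ∩ (a ∪ B ∩ C)) =
      prob p a - prob p (a ∩ A) * prob p C + prob p (B ∩ Aᶜ) * prob p C := by
    have e : (A ∩ C)ᶜ ∩ (a ∪ B ∩ C) = ((A ∩ C)ᶜ ∩ a) ∪ ((B ∩ Aᶜ) ∩ C) := by
      ext ω
      simp only [Set.mem_inter_iff, Set.mem_union, Set.mem_compl_iff]
      constructor
      · rintro ⟨hq, hu'⟩
        rcases hu' with hu' | ⟨hb, hc⟩
        · exact Or.inl ⟨hq, hu'⟩
        · exact Or.inr ⟨⟨hb, fun hA' => hq ⟨hA', hc⟩⟩, hc⟩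
      · rintro (⟨hq, hu'⟩ | ⟨⟨hb, hna⟩, hc⟩)
        · exact ⟨hq, Or.inl hu'⟩
        · exact ⟨fun hAC => hna hAC.1, Or.inr ⟨hb, hc⟩⟩
    have hdisj : Disjoint ((A ∩ C)ᶜ ∩ a) ((B ∩ Aᶜ) ∩ C) := by
      rw [Set.disjoint_left]
      rintro ω ⟨_, hu'⟩ ⟨⟨hb, hna⟩, _⟩
      exact hna (hBa ⟨hb, hu'⟩)
    rw [e, prob_union_of_disjoint p hdisj, h3, prob_inter_left_right p dBA dC]
  -- (2) `P(Q ∩ U ∩ O)`: three disjoint rectangles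
  have h2 : prob p ((A ∩ C)ᶜ ∩ ((a ∪ B ∩ C) ∩ (l ∪ A ∩ D))) =
      prob p a * prob p l - prob p (a ∩ A) * prob p (l ∩ C) +
        prob p (a ∩ A) * prob p (D ∩ Cᶜ) + prob p (B ∩ Aᶜ) * prob p (l ∩ C) := by
    have e : (A ∩ C)ᶜ ∩ ((a ∪ B ∩ C) ∩ (l ∪ A ∩ D)) =
        (((A ∩ C)ᶜ ∩ (a ∩ l)) ∪ ((a ∩ A) ∩ (D ∩ Cᶜ))) ∪ ((B ∩ Aᶜ) ∩ (l ∩ C)) := by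
      ext ω
      simp only [Set.mem_inter_iff, Set.mem_union, Set.mem_compl_iff]
      constructor
      · rintro ⟨hq, hU, hO⟩
        rcases hU with hu' | ⟨hb, hc⟩
        · rcases hO with hl' | ⟨hA', hd⟩
          · exact Or.inl (Or.inl ⟨hq, hu', hl'⟩)
          · exact Or.inl (Or.inr ⟨⟨hu', hA'⟩, hd, fun hc => hq ⟨hA', hc⟩⟩)
        · have hna : ω ∉ A := fun hA' => hq ⟨hA', hc⟩
          rcases hO with hl' | ⟨hA', _⟩
          · exact Or.inr ⟨⟨hb, hna⟩, hl', hc⟩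
          · exact absurd hA' hna
      · rintro ((⟨hq, hu', hl'⟩ | ⟨⟨hu', hA'⟩, hd, hnc⟩) | ⟨⟨hb, hna⟩, hl', hc⟩)
        · exact ⟨hq, Or.inl hu', Or.inl hl'⟩
        · exact ⟨fun hAC => hnc hAC.2, Or.inl hu', Or.inr ⟨hA', hd⟩⟩
        · exact ⟨fun hAC => hna hAC.1, Or.inr ⟨hb, hc⟩, Or.inl hl'⟩
    have hd12 : Disjoint ((A ∩ C)ᶜ ∩ (a ∩ l)) ((a ∩ A) ∩ (D ∩ Cᶜ)) := by
      rw [Set.disjoint_left]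
      rintro ω ⟨_, _, hl'⟩ ⟨_, hd, hnc⟩
      exact hnc (hDl ⟨hd, hl'⟩)
    have hd3 : Disjoint (((A ∩ C)ᶜ ∩ (a ∩ l)) ∪ ((a ∩ A) ∩ (D ∩ Cᶜ))) ((B ∩ Aᶜ) ∩ (l ∩ C)) := by
      rw [Set.disjoint_left]
      rintro ω hx ⟨⟨hb, hna⟩, _, _⟩
      rcases hx with ⟨_, hu', _⟩ | ⟨⟨_, hA'⟩, _⟩
      · exact hna (hBa ⟨hb, hu'⟩)
      · exact hna hA'
    have hX1 : prob p ((A ∩ C)ᶜ ∩ (a ∩ l)) =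
        prob p a * prob p l - prob p (a ∩ A) * prob p (l ∩ C) := by
      have e0 := prob_inter_add_prob_inter_compl p (a ∩ l) (A ∩ C)
      have e1 : a ∩ l ∩ (A ∩ C) = (a ∩ A) ∩ (l ∩ C) := by
        ext ω; simp only [Set.mem_inter_iff]; tauto
      rw [e1, prob_inter_left_right p daA dlC, prob_inter_left_right p da dl,
        Set.inter_comm (a ∩ l) (A ∩ C)ᶜ] at e0
      linear_combination e0
    rw [e, prob_union_of_disjoint p hd3, prob_union_of_disjoint p hd12, hX1,
      prob_inter_left_right p daA dDC, prob_inter_left_right p dBA dlC]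
  rw [h1, h2, h3, h4, h5, h6]
  ring

/-- **The glued family, (XW) read on the `s–y` edge**: on a cut-vertex configuration the defect
vanishes iff `A₃·Δ_R + C₃·Δ_L = Δ_L·Δ_R`, and it is negative exactly when
`Δ_L·Δ_R > A₃·Δ_R + C₃·Δ_L` (so an `s–y` edge of any weight `t ∈ (0, 1)` then breaks (XW):
`XW = t(1 − t)·D_sy` on that configuration, `xwBil_eq_sy_edge` + `xwBil_eq_zero_of_cut_su_yo`). -/
theorem dSY_neg_iff_glue (h : CutVertex ends side L v Rt) {s u y o : V}
    (hs : s ∈ L ∨ s = v) (hu : u ∈ L ∨ u = v) (hy : y ∈ Rt ∨ y = v) (ho : o ∈ Rt ∨ o = v)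
    (p : E → R) :
    XWEdgeSY.dSY ends s y o u p < 0 ↔
      (prob p (connEvent ends s u ∩ connEvent ends s v) -
            prob p (connEvent ends s v) * prob p (connEvent ends s u)) *
          (prob p (connEvent ends y o ∩ connEvent ends y v) -
            prob p (connEvent ends y v) * prob p (connEvent ends y o)) >
        prob p (connEvent ends u v ∩ (connEvent ends s v)ᶜ) *
            (prob p (connEvent ends y o ∩ connEvent ends y v) -
              prob p (connEvent ends y v) * prob p (connEvent ends y o)) +
          prob p (connEvent ends o v ∩ (connEvent ends y v)ᶜ) *
            (prob p (connEvent ends s u ∩ connEvent ends s v) -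
              prob p (connEvent ends s v) * prob p (connEvent ends s u)) := by
  rw [dSY_eq_glue h hs hu hy ho p]
  constructor <;> intro hh <;> linarith

end XWGlue

end Summit.Ventures.PercRepro2
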